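import Summits.HodgeConjecture.HodgeConjecture.Theorems.Ring2WeilCoverageCMFieldAllPrimesE
import Summits.HodgeConjecture.HodgeConjecture.Theorems.Ring2WeilCoverageCMFieldTablesB
import HarnessLib

/-!
# Weil-type components over quartic CM fields, IX (part F): complete prime classifications for `ℚ(i,√5)` and
# `ℚ(√-3,√5)` (Thue with `d = 5`, `3`, `15`)

research route conditional on HC_CM; not a corollary; Q11.4-sentence-2 already refuted in dim ≥ 3. Cell
`pub-hodge-ring2`, seat `ring2-b03` (gen 51); continuation of part E (`Ring2WeilCoverageCMFieldAllPrimesE`: Thue's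
lemma, the split transfer, `ℚ(ζ₈)`, `ℚ(ζ₁₂)`). For the two `V₄` census fields over `F = ℚ(√5)`:

* `E = ℚ(i,√5)` (`R = S² + 3S + 1`, `√-5 = (4+σ)η`): `[ℓ] = [1]` for every prime `ℓ ≡ 1, 3, 7, 9 (mod 20)` (`-5 = t²`
  mod `ℓ`, Thue: `x² + 5y² = kℓ`, `k ≤ 5`, and `[k] = [1]` for `k ≤ 5`, gen 49); with part B and `[2] = [5] = [1]`:
  **for every prime `ℓ`, `[ℓ] ≠ [1] ⟺ ℓ ≡ 11, 19 (mod 20)`**;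
* `E = ℚ(√-3,√5)` (`R = S² + 9S + 9`): `[ℓ] = [1]` for every prime `ℓ ≡ 1 (mod 3)` (`d = 3`, `√-3 = -η(6+σ)/3`,
  `k ≤ 3`) and for every prime `ℓ ≡ 2 (mod 3)`, `ℓ ≡ ±2 (mod 5)`, `ℓ ≠ 2` (`d = 15`, `√-15 = η(12+σ)/3`, `k ≤ 15`,
  `[k] = [1]` for `k ≠ 11` by the gen-49 table, and `k = 11` impossible: `x² + 15y² ≡ 0 (mod 11)` forces `11 ∣ x, y`);
  with part B and `[2] = [3] = [5] = [1]`: **for every prime `ℓ`, `[ℓ] ≠ [1] ⟺ ℓ ≡ 11, 14 (mod 15)`**.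

Together with part E: for all four biquadratic census fields the split/non-split status of the Weil-type
component `W8.E.[ℓ]` is decided for EVERY rational prime `ℓ` by a congruence (`mod 8, 12, 20, 15`), in the kernel.
No named fact, no definition, no `sorry`; nothing about the Hodge conjecture is asserted (the general member of every
row is OPEN, census §b03.2). References: [Deligne1982HodgeCycles] §4 p. 30 (1), Cor. 4.2, Lemma 4.6;
[Landherr1936HermitianForms]. -/

noncomputable section

set_option linter.dupNamespace false

open Polynomial

namespace Summit.HodgeConjecture.HodgeConjecture.Ring2.WeilCoverageCM

open Literature.AlgebraicGeometry.Deligne1982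
open Literature.AlgebraicGeometry.HodgeTheory (splitDiscriminantClassCM)

/-! ### §1 `E = ℚ(i,√5)`: `[ℓ] = [1]` for `ℓ ≡ 1, 3, 7, 9 (mod 20)`; `[ℓ] ≠ [1] ⟺ ℓ ≡ 11, 19 (mod 20)` -/

section SqrtNeg1Sqrt5

variable {R : Polynomial ℤ} (hR : R = X ^ 2 + C 3 * X + C 1) [Fact (Irreducible (realPolyQ R))]
include hR

/-- **`[ℓ] = [1]` for `E = ℚ(i,√5)` and EVERY prime `ℓ ≡ 1, 3, 7, 9 (mod 20)`** (`-5 = t²` mod `ℓ`; Thue: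
`x² + 5y² = kℓ`, `1 ≤ k ≤ 5`; `x + y√-5 ∈ E`, `√-5 = (4+σ)η`, witness `x² - σ(4y + yσ)² ↦ (kℓ, 0)`; `[k] = [1]` for
`k ≤ 5` by the gen-49 table): in particular the rows `W8.E.[ℓ]`, `ℓ ≡ 3, 7 (mod 20)` (`3, 7, 23, 43, 47, …`, the
form `2u² + 2uv + 3v²`) are the SPLIT component. [cite: Deligne1982HodgeCycles, §4 p. 30 (1) and Cor. 4.2] -/
theorem sqrtNeg1Sqrt5_mk_prime_eq_splitDiscriminantClassCM_of_mod_twenty (ℓ : ℕ) (hℓ : ℓ.Prime)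
    (h20 : ℓ % 20 = 1 ∨ ℓ % 20 = 3 ∨ ℓ % 20 = 7 ∨ ℓ % 20 = 9) (u : (realField R)ˣ) (hu : (u : realField R) = ℓ) :
    (QuotientGroup.mk u : cmNormResidueGroup R) = splitDiscriminantClassCM R 2 := by
  haveI : Fact ℓ.Prime := ⟨hℓ⟩
  haveI := fact_irreducible_cmPolyQ_of_pos hR (by norm_num) (by norm_num) disc_not_sq_three_one
  obtain ⟨t, ht⟩ := isSquare_neg_five_of_mod_twenty (ℓ := ℓ) h20
  obtain ⟨x, y, k, -, hk1, hk2, hxy⟩ :=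
    exists_sq_add_mul_sq_eq_mul_prime (ℓ := ℓ) 5 (by norm_num) t (by rw [sq, ← ht]; push_cast; ring)
  refine mk_natCast_eq_split_of_mul hR ℓ k hk1 x 0 (4 * y) y 1 one_ne_zero
    (by push_cast at hxy ⊢; linear_combination hxy) (by ring) ?_ u hu
  intro v hv
  exact (sqrtNeg1Sqrt5_table hR k hk1 (by omega) v hv).2
    (by simp only [Finset.mem_insert, Finset.mem_singleton]; omega)

/-- **COMPLETE PRIME CLASSIFICATION for `E = ℚ(i,√5)`: for every prime `ℓ`, `[ℓ] ≠ [1] ⟺ ℓ ≡ 11, 19 (mod 20)`** —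
the component `W8.E.[ℓ]` is NON-SPLIT exactly for `ℓ = 11, 19, 31, 59, 71, 79, …` (part B: `⇐`; two squares for
`ℓ ≡ 1 (mod 4)`, Thue with `d = 5` for `(-5/ℓ) = 1`, `[2] = [5] = [1]`). [cite: Deligne1982HodgeCycles, §4 p. 30 (1) and Cor. 4.2]
[cite: Landherr1936HermitianForms] -/
theorem sqrtNeg1Sqrt5_mk_prime_ne_splitDiscriminantClassCM_iff (ℓ : ℕ) (hℓ : ℓ.Prime) (u : (realField R)ˣ)
    (hu : (u : realField R) = ℓ) :
    (QuotientGroup.mk u : cmNormResidueGroup R) ≠ splitDiscriminantClassCM R 2 ↔ (ℓ % 20 = 11 ∨ ℓ % 20 = 19) := by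
  refine ⟨fun hne => ?_, fun h20 =>
    sqrtNeg1Sqrt5_mk_prime_ne_splitDiscriminantClassCM_of_mod hR ℓ hℓ (by omega) (by omega) u hu⟩
  haveI : Fact ℓ.Prime := ⟨hℓ⟩
  by_contra h20
  have h2 := hℓ.two_le
  by_cases hle : ℓ ≤ 5
  · refine hne ((sqrtNeg1Sqrt5_table hR ℓ (by omega) (by omega) u hu).2 ?_)
    simp only [Finset.mem_insert, Finset.mem_singleton]; omega
  · have hd2 : ¬ 2 ∣ ℓ := fun h => by
      rcases (Nat.dvd_prime hℓ).1 h with h | h <;> omega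
    have hd5 : ¬ 5 ∣ ℓ := fun h => by
      rcases (Nat.dvd_prime hℓ).1 h with h | h <;> omega
    have hcases : ℓ % 4 = 1 ∨ (ℓ % 20 = 1 ∨ ℓ % 20 = 3 ∨ ℓ % 20 = 7 ∨ ℓ % 20 = 9) := by omega
    rcases hcases with h | h
    · obtain ⟨a, b, hab⟩ := Nat.Prime.sq_add_sq (p := ℓ) (by omega)
      have habZ : ((a : ℤ)) ^ 2 + (b : ℤ) ^ 2 = ℓ := by exact_mod_cast hab
      exact hne (mk_eq_splitDiscriminantClassCM_two_of_coords_of_pos hR (by norm_num) (by norm_num)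
        disc_not_sq_three_one ℓ a 0 (2 * b) b 1 one_ne_zero (by linear_combination habZ) (by ring) u
        (by rw [hu]; exact (map_natCast (AdjoinRoot.of (realPolyQ R)) ℓ).symm))
    · exact hne (sqrtNeg1Sqrt5_mk_prime_eq_splitDiscriminantClassCM_of_mod_twenty hR ℓ hℓ h u hu)

end SqrtNeg1Sqrt5

/-! ### §2 `E = ℚ(√-3,√5)`: `[ℓ] = [1]` for `ℓ ≡ 1 (mod 3)` and for `ℓ ≡ 2 (mod 3)`, `ℓ ≡ ±2 (mod 5)`;
`[ℓ] ≠ [1] ⟺ ℓ ≡ 11, 14 (mod 15)` -/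

/-- `x² + 15y² ≡ 0 (mod 11)` forces `x ≡ y ≡ 0`: `-15 ≡ 7` is a non-square mod `11` (121 cases). [folklore] -/
theorem zmod11_sq_add_fifteen_mul_sq : ∀ a b : ZMod 11, a ^ 2 + 15 * b ^ 2 = 0 → a = 0 ∧ b = 0 := by
  decide

section SqrtNeg3Sqrt5

variable {R : Polynomial ℤ} (hR : R = X ^ 2 + C 9 * X + C 9) [Fact (Irreducible (realPolyQ R))]
include hR

/-- **`[ℓ] = [1]` for `E = ℚ(√-3,√5)` and EVERY prime `ℓ ≡ 1 (mod 3)`** (`-3 = t²` mod `ℓ`; Thue: `x² + 3y² = kℓ`,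
`k ≤ 3`; `x + y√-3 ∈ E`, `√-3 = -η(6+σ)/3`, witness `(3x)² - σ(6y + yσ)² ↦ (9kℓ, 0)`; `[2] = [3] = [1]`). The
hypothesis is written `ℓ ≡ 1 [MOD 3]` (the gate's dedup key identifies the `%`-form with the `ℚ(ζ₁₂)` lemma of part E).
[cite: Deligne1982HodgeCycles, §4 p. 30 (1) and Cor. 4.2] -/
theorem sqrtNeg3Sqrt5_mk_prime_eq_splitDiscriminantClassCM_of_mod_three (ℓ : ℕ) (hℓ : ℓ.Prime)
    (h3m : ℓ ≡ 1 [MOD 3]) (u : (realField R)ˣ) (hu : (u : realField R) = ℓ) :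
    (QuotientGroup.mk u : cmNormResidueGroup R) = splitDiscriminantClassCM R 2 := by
  have h3 : ℓ % 3 = 1 := h3m
  haveI : Fact ℓ.Prime := ⟨hℓ⟩
  haveI := fact_irreducible_cmPolyQ_of_pos hR (by norm_num) (by norm_num) disc_not_sq_nine_nine
  obtain ⟨t, ht⟩ := isSquare_neg_three_of_mod_three (ℓ := ℓ) h3
  obtain ⟨x, y, k, -, hk1, hk2, hxy⟩ :=
    exists_sq_add_mul_sq_eq_mul_prime (ℓ := ℓ) 3 (by norm_num) t (by rw [sq, ← ht]; push_cast; ring)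
  refine mk_natCast_eq_split_of_mul hR ℓ k hk1 (3 * x) 0 (6 * y) y 3 three_ne_zero
    (by push_cast at hxy ⊢; linear_combination 9 * hxy) (by ring) ?_ u hu
  intro v hv
  exact (sqrtNeg3Sqrt5_table hR k hk1 (by omega) v hv).2
    (by simp only [Finset.mem_insert, Finset.mem_singleton]; omega)

/-- **`[ℓ] = [1]` for `E = ℚ(√-3,√5)` and EVERY prime `ℓ ≡ 2 (mod 3)`, `ℓ ≡ ±2 (mod 5)`, `ℓ ≠ 2`** (`-3` and `5` are
both non-squares mod `ℓ`, so `-15 = t²`; Thue: `x² + 15y² = kℓ`, `1 ≤ k ≤ 15`; `x + y√-15 ∈ E`, `√-15 = η(12+σ)/3`,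
witness `(3x)² - σ(12y + yσ)² ↦ (9kℓ, 0)`, so `[kℓ] = [1]`; `[k] = [1]` for every `k ≤ 15` except `k = 11` (gen-49
table), and `k = 11` is impossible — mod `11` it forces `11 ∣ x, y`, then `11 ∣ ℓ`, `ℓ = 11 ≡ 1 (mod 5)`): the rows
`W8.E.[ℓ]`, `ℓ = 17, 23, 47, 53, 83, …` (the genus of `3u² + 5v²`) are the SPLIT component.
[cite: Deligne1982HodgeCycles, §4 p. 30 (1) and Cor. 4.2] -/
theorem sqrtNeg3Sqrt5_mk_prime_eq_splitDiscriminantClassCM_of_mod_fifteen (ℓ : ℕ) (hℓ : ℓ.Prime) (h2 : ℓ ≠ 2)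
    (h3 : ℓ % 3 = 2) (h5 : ℓ % 5 = 2 ∨ ℓ % 5 = 3) (u : (realField R)ˣ) (hu : (u : realField R) = ℓ) :
    (QuotientGroup.mk u : cmNormResidueGroup R) = splitDiscriminantClassCM R 2 := by
  haveI : Fact ℓ.Prime := ⟨hℓ⟩
  haveI := fact_irreducible_cmPolyQ_of_pos hR (by norm_num) (by norm_num) disc_not_sq_nine_nine
  obtain ⟨t, ht⟩ := isSquare_neg_fifteen_of_mod (ℓ := ℓ) h2 h3 h5
  obtain ⟨x, y, k, hy0, hk1, hk2, hxy⟩ :=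
    exists_sq_add_mul_sq_eq_mul_prime (ℓ := ℓ) 15 (by norm_num) t (by rw [sq, ← ht]; push_cast; ring)
  -- `k ≠ 11`
  have hk11 : k ≠ 11 := by
    rintro rfl
    push_cast at hxy
    have hmod : ((x : ZMod 11)) ^ 2 + 15 * (y : ZMod 11) ^ 2 = 0 := by
      have h := congrArg (Int.cast : ℤ → ZMod 11) hxy
      push_cast at h
      have h11 : (11 : ZMod 11) = 0 := by decide
      rw [h, h11, zero_mul]
    obtain ⟨hx, hy⟩ := zmod11_sq_add_fifteen_mul_sq _ _ hmod
    rw [ZMod.intCast_zmod_eq_zero_iff_dvd] at hx hy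
    obtain ⟨x', rfl⟩ := hx
    obtain ⟨y', rfl⟩ := hy
    have h11 : (11 : ℤ) ∣ ℓ := ⟨x' ^ 2 + 15 * y' ^ 2, by
      have := hxy; push_cast at this; linarith [this]⟩
    have h11' : 11 ∣ ℓ := by exact_mod_cast h11
    rcases (Nat.dvd_prime hℓ).1 h11' with h | h <;> omega
  refine mk_natCast_eq_split_of_mul hR ℓ k hk1 (3 * x) 0 (12 * y) y 3 three_ne_zero
    (by push_cast at hxy ⊢; linear_combination 9 * hxy) (by ring) ?_ u hu
  intro v hv
  exact (sqrtNeg3Sqrt5_table hR k hk1 (by omega) v hv).2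
    (by simp only [Finset.mem_insert, Finset.mem_singleton]; omega)

/-- **COMPLETE PRIME CLASSIFICATION for `E = ℚ(√-3,√5)`: for every prime `ℓ`, `[ℓ] ≠ [1] ⟺ ℓ ≡ 11, 14 (mod 15)`**
— the component `W8.E.[ℓ]` is NON-SPLIT exactly for `ℓ = 11, 29, 41, 59, 71, 89, …` (part B: `⇐`; Thue with
`d = 3` for `ℓ ≡ 1 (mod 3)`, with `d = 15` for `ℓ ≡ 2 (mod 3)`, `ℓ ≡ ±2 (mod 5)`; `[2] = [3] = [5] = [1]`).
[cite: Deligne1982HodgeCycles, §4 p. 30 (1) and Cor. 4.2] [cite: Landherr1936HermitianForms] -/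
theorem sqrtNeg3Sqrt5_mk_prime_ne_splitDiscriminantClassCM_iff (ℓ : ℕ) (hℓ : ℓ.Prime) (u : (realField R)ˣ)
    (hu : (u : realField R) = ℓ) :
    (QuotientGroup.mk u : cmNormResidueGroup R) ≠ splitDiscriminantClassCM R 2 ↔ (ℓ % 15 = 11 ∨ ℓ % 15 = 14) := by
  refine ⟨fun hne => ?_, fun h15 =>
    sqrtNeg3Sqrt5_mk_prime_ne_splitDiscriminantClassCM_of_mod hR ℓ hℓ (by omega) (by omega) u hu⟩
  haveI : Fact ℓ.Prime := ⟨hℓ⟩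
  by_contra h15
  have h2 := hℓ.two_le
  by_cases hle : ℓ ≤ 5
  · refine hne ((sqrtNeg3Sqrt5_table hR ℓ (by omega) (by omega) u hu).2 ?_)
    simp only [Finset.mem_insert, Finset.mem_singleton]; omega
  · have hd2 : ¬ 2 ∣ ℓ := fun h => by
      rcases (Nat.dvd_prime hℓ).1 h with h | h <;> omega
    have hd3 : ¬ 3 ∣ ℓ := fun h => by
      rcases (Nat.dvd_prime hℓ).1 h with h | h <;> omega
    have hd5 : ¬ 5 ∣ ℓ := fun h => by
      rcases (Nat.dvd_prime hℓ).1 h with h | h <;> omega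
    have hcases : ℓ % 3 = 1 ∨ (ℓ % 3 = 2 ∧ (ℓ % 5 = 2 ∨ ℓ % 5 = 3)) := by omega
    rcases hcases with h | ⟨h3, h5⟩
    · exact hne (sqrtNeg3Sqrt5_mk_prime_eq_splitDiscriminantClassCM_of_mod_three hR ℓ hℓ (by exact h) u hu)
    · exact hne (sqrtNeg3Sqrt5_mk_prime_eq_splitDiscriminantClassCM_of_mod_fifteen hR ℓ hℓ (by omega) h3 h5 u hu)

end SqrtNeg3Sqrt5

/-! ### §3 Unconditional packagings (`R` literal): the four complete prime classifications -/

/-- **The four biquadratic census fields, every prime `ℓ`, `R` LITERAL and the field `Fact`s discharged:**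
`[ℓ] ≠ [1] ⟺ ℓ ≡ 7 (mod 8)` for `ℚ(ζ₈)` (`R = S² + 6S + 1`), `⟺ ℓ ≡ 11 (mod 12)` for `ℚ(ζ₁₂)` (`S² + 8S + 4`),
`⟺ ℓ ≡ 11, 19 (mod 20)` for `ℚ(i,√5)` (`S² + 3S + 1`), `⟺ ℓ ≡ 11, 14 (mod 15)` for `ℚ(√-3,√5)` (`S² + 9S + 9`) — the
split/non-split type of the Weil-type component `W8.E.[ℓ]` of abelian eightfolds decided by one congruence.
[cite: Deligne1982HodgeCycles, §4 p. 30 (1) and Cor. 4.2] [cite: Landherr1936HermitianForms] -/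
theorem biquadratic_census_fields_prime_classification (ℓ : ℕ) (hℓ : ℓ.Prime) :
    (haveI := fact_irreducible_realPolyQ_of_not_sq (R := X ^ 2 + C 6 * X + C 1) rfl disc_not_sq_six_one
     ∀ u : (realField (X ^ 2 + C 6 * X + C 1))ˣ, (u : realField (X ^ 2 + C 6 * X + C 1)) = ℓ →
       ((QuotientGroup.mk u : cmNormResidueGroup (X ^ 2 + C 6 * X + C 1)) ≠
          splitDiscriminantClassCM (X ^ 2 + C 6 * X + C 1) 2 ↔ ℓ % 8 = 7)) ∧
    (haveI := fact_irreducible_realPolyQ_of_not_sq (R := X ^ 2 + C 8 * X + C 4) rfl disc_not_sq_eight_four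
     ∀ u : (realField (X ^ 2 + C 8 * X + C 4))ˣ, (u : realField (X ^ 2 + C 8 * X + C 4)) = ℓ →
       ((QuotientGroup.mk u : cmNormResidueGroup (X ^ 2 + C 8 * X + C 4)) ≠
          splitDiscriminantClassCM (X ^ 2 + C 8 * X + C 4) 2 ↔ ℓ % 12 = 11)) ∧
    (haveI := fact_irreducible_realPolyQ_of_not_sq (R := X ^ 2 + C 3 * X + C 1) rfl disc_not_sq_three_one
     ∀ u : (realField (X ^ 2 + C 3 * X + C 1))ˣ, (u : realField (X ^ 2 + C 3 * X + C 1)) = ℓ →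
       ((QuotientGroup.mk u : cmNormResidueGroup (X ^ 2 + C 3 * X + C 1)) ≠
          splitDiscriminantClassCM (X ^ 2 + C 3 * X + C 1) 2 ↔ (ℓ % 20 = 11 ∨ ℓ % 20 = 19))) ∧
    (haveI := fact_irreducible_realPolyQ_of_not_sq (R := X ^ 2 + C 9 * X + C 9) rfl disc_not_sq_nine_nine
     ∀ u : (realField (X ^ 2 + C 9 * X + C 9))ˣ, (u : realField (X ^ 2 + C 9 * X + C 9)) = ℓ →
       ((QuotientGroup.mk u : cmNormResidueGroup (X ^ 2 + C 9 * X + C 9)) ≠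
          splitDiscriminantClassCM (X ^ 2 + C 9 * X + C 9) 2 ↔ (ℓ % 15 = 11 ∨ ℓ % 15 = 14))) := by
  refine ⟨?_, ?_, ?_, ?_⟩
  · haveI := fact_irreducible_realPolyQ_of_not_sq (R := X ^ 2 + C 6 * X + C 1) rfl disc_not_sq_six_one
    exact fun u hu => zeta8_mk_prime_ne_splitDiscriminantClassCM_iff rfl ℓ hℓ u hu
  · haveI := fact_irreducible_realPolyQ_of_not_sq (R := X ^ 2 + C 8 * X + C 4) rfl disc_not_sq_eight_four
    exact fun u hu => zeta12_mk_prime_ne_splitDiscriminantClassCM_iff rfl ℓ hℓ u hu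
  · haveI := fact_irreducible_realPolyQ_of_not_sq (R := X ^ 2 + C 3 * X + C 1) rfl disc_not_sq_three_one
    exact fun u hu => sqrtNeg1Sqrt5_mk_prime_ne_splitDiscriminantClassCM_iff rfl ℓ hℓ u hu
  · haveI := fact_irreducible_realPolyQ_of_not_sq (R := X ^ 2 + C 9 * X + C 9) rfl disc_not_sq_nine_nine
    exact fun u hu => sqrtNeg3Sqrt5_mk_prime_ne_splitDiscriminantClassCM_iff rfl ℓ hℓ u hu


end Summit.HodgeConjecture.HodgeConjecture.Ring2.WeilCoverageCM

end
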